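import Summits.BirchSwinnertonDyer.BirchSwinnertonDyer.Theorems.AdditiveKolyvaginRoadRamifiedHabitatPStarTwistLocal
import Literature.NumberTheory.EllipticCurves.KrausNonMinimalityTwoThreeProofs
import HarnessLib

/-!
# Route `AdditiveKolyvaginRoad`, crux KS′ `LevelKolyvaginSystemsAdditive` (stmt-BirchSwinnertonDyer-21396), card `ramified-toric-habitat` —
# part 5 (LOCAL, STARRED TYPES): the minimal model and Rohrlich's local root number of `E^{(p*)}` at an additive potentially good
# prime `p ≥ 5` of Kodaira type IV*, III* or II* (`ord_p Δ_min ∈ {8, 9, 10}`)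

Cell `pub/bsd-wall`, width seat `bsd-wall-akr-p2x-w2` g11; `--supports stmt-BirchSwinnertonDyer-21396` (helper). THEOREMS ONLY; no definition,
no named fact, no `sorry`. BSD is not proved by any of this; KS′/KPA′ stay OPEN at `p² ∣ N`.

Part 1 (`…RamifiedHabitatPStarTwistLocal`) treated the LOW branch `ord_p Δ(X) = a`, `a + 6 < 12`, where the twisted minimal model
`X^{(p*)}` is itself minimal. Here the HIGH branch: for `12 ≤ a + 6` the `u = p` rescaling of the short normal form of `X^{(p*)}`,
`y² = x³ − (c₄/48p²)·x ∓ (c₆/864p³)`, is `p`-integral as soon as `ord_p c₄ ≥ 2`, `ord_p c₆ ≥ 3` (automatic on the potentially good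
additive rows with `a ≥ 8`: `3 ord c₄ ≥ a`, and `c₆² = c₄³ − 1728Δ`), with `ord_p Δ = a − 6 < 12`, hence minimal
(Silverman, *AEC* VII.1 Remark 1.1; Mathlib's `toShortNF`, the tree's `toShortNF_smul_eq_of_c₄_c₆` / `scale_smul_short`):

* `addVal_minimal_pStarTwist_padic_of_ge` — `ord_p Δ = a − 6`, `ord_p c₄ = ord_p c₄(X) − 2` for the minimal model of `E^{(p*)}` at `p`;
* `localRootNumber_mul_pStarTwist_padic_of_ge` — for `a ∈ {8, 9, 10}` (`e = 12/gcd(12,a) = 3, 4, 6`; twist: `e' = 6, 4, 3`) both minimal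
  models are ADDITIVE potentially good and `W_p(E)·W_p(E^{(p*)}) = (−1/p)(−3/p)` for `a ∈ {8, 10}`, `= 1` for `a = 9` — the same table as
  for types II/III/IV (Rohrlich, Compositio 87 (1993) Prop. 2(iv) = the tree's `localRootNumber`).

Part 6 (`…RamifiedHabitatSignLawStarred`) feeds this into the sign-law assembly of parts 2–4.

References: [cite: SilvermanAEC2009, VII.1 Remark 1.1 and Prop. 1.3(b); III.1] [cite: Rohrlich1993Compositio, Prop. 2(iv)].
-/

set_option autoImplicit false
set_option linter.dupNamespace false

noncomputable section

open scoped Classical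

open IsDedekindDomain IsDedekindDomain.HeightOneSpectrum NumberField Rat.HeightOneSpectrum
  WeierstrassCurve Literature.NumberTheory.EllipticCurves IsDiscreteValuationRing

namespace Summit.BirchSwinnertonDyer.BirchSwinnertonDyer.Theorems.AdditiveKoly.RamifiedHabitat

section PadicStarred

variable {p : ℕ} [Fact p.Prime]

/-- In `ℤ_p`: if `n ≤ ord(x)` then `x = p^n · y` for some `y ∈ ℤ_p` (unit-times-power decomposition in a DVR).
[folklore] -/
theorem exists_eq_pow_mul_of_le_addVal {x : ℤ_[p]} {n : ℕ} (h : (n : ℕ∞) ≤ addVal ℤ_[p] x) :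
    ∃ y : ℤ_[p], x = (p : ℤ_[p]) ^ n * y := by
  by_cases hx : x = 0
  · exact ⟨0, by rw [hx, mul_zero]⟩
  obtain ⟨m, u, hxu⟩ := eq_unit_mul_pow_irreducible hx (PadicInt.irreducible_p (p := p))
  have hm : addVal ℤ_[p] x = m := addVal_def x u PadicInt.irreducible_p m hxu
  rw [hm] at h
  have hnm : n ≤ m := by exact_mod_cast h
  refine ⟨(u : ℤ_[p]) * (p : ℤ_[p]) ^ (m - n), ?_⟩
  rw [hxu, mul_left_comm, ← pow_add, Nat.add_sub_cancel' hnm]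

/-- **The minimal model of `E^{(p*)}` at `p` from that of `E`, high branch (types IV*, III*, II*).** Let `X` be the chosen
`ℤ_p`-minimal model of `E/ℚ_p` (`p ≥ 5`) with `ord_p Δ(X) = a`, `12 ≤ a + 6`, `a < 18`, `ord_p c₄(X) ≥ 2`, `ord_p c₆(X) ≥ 3`. Then the
`u = p` rescaling of the short normal form of `X^{(p*)}` — `y² = x³ − (c₄/48 p²)x ∓ c₆/(864 p³)` — is `p`-integral with
`ord_p Δ = a − 6 < 12`, hence minimal (Silverman, *AEC* VII.1 Remark 1.1), so the chosen minimal model of `E^{(p*)}/ℚ_p` has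
`ord_p Δ = a − 6` and `ord_p c₄ = ord_p c₄(X) − 2` (Prop. 1.3(b)). [cite: SilvermanAEC2009, VII.1 Remark 1.1 and Prop. 1.3(b)] -/
theorem addVal_minimal_pStarTwist_padic_of_ge (W : WeierstrassCurve ℚ) [W.IsElliptic] (hp5 : 5 ≤ p) {a : ℕ}
    (hΔ : addVal ℤ_[p] (((W.baseChange ℚ_[p]).minimal ℤ_[p]).integralModel ℤ_[p]).Δ = a) (ha : 12 ≤ a + 6)
    (ha' : a < 18) (hc₄ : (2 : ℕ∞) ≤ addVal ℤ_[p] (((W.baseChange ℚ_[p]).minimal ℤ_[p]).integralModel ℤ_[p]).c₄)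
    (hc₆ : (3 : ℕ∞) ≤ addVal ℤ_[p] (((W.baseChange ℚ_[p]).minimal ℤ_[p]).integralModel ℤ_[p]).c₆) :
    addVal ℤ_[p] ((((W.quadraticTwist (((-1 : ℤ) ^ (p / 2) * p : ℤ) : ℚ)).baseChange ℚ_[p]).minimal
        ℤ_[p]).integralModel ℤ_[p]).Δ = (a - 6 : ℕ) ∧
      addVal ℤ_[p] ((((W.quadraticTwist (((-1 : ℤ) ^ (p / 2) * p : ℤ) : ℚ)).baseChange ℚ_[p]).minimal
          ℤ_[p]).integralModel ℤ_[p]).c₄ + 2 =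
        addVal ℤ_[p] (((W.baseChange ℚ_[p]).minimal ℤ_[p]).integralModel ℤ_[p]).c₄ := by
  have hvald := addVal_padicInt_pStar (p := p)
  have hVd := valuation_padic_pStar (p := p)
  set d : ℤ := (-1 : ℤ) ^ (p / 2) * p with hd
  set V := (IsDiscreteValuationRing.maximalIdeal ℤ_[p]).valuation ℚ_[p] with hV
  have hp : p.Prime := Fact.out
  have hp2 : p ≠ 2 := by omega
  have hdZ0 : d ≠ 0 :=
    mul_ne_zero (pow_ne_zero _ (by norm_num)) (by exact_mod_cast hp.ne_zero)
  have hd0 : (d : ℚ) ≠ 0 := by exact_mod_cast hdZ0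
  have hdK0 : (d : ℚ_[p]) ≠ 0 := by exact_mod_cast hdZ0
  have hdK : (d : ℚ_[p]) = algebraMap ℤ_[p] ℚ_[p] (d : ℤ_[p]) := by simp
  have hp0 : (p : ℚ_[p]) ≠ 0 := by exact_mod_cast hp.ne_zero
  haveI : (W.quadraticTwist (d : ℚ)).IsElliptic := W.isElliptic_quadraticTwist hd0
  set Wp := W.baseChange ℚ_[p] with hWp
  set W'p := (W.quadraticTwist (d : ℚ)).baseChange ℚ_[p] with hW'p
  haveI : Wp.IsElliptic := by rw [hWp]; change (W.map _).IsElliptic; infer_instance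
  haveI : W'p.IsElliptic := by rw [hW'p]; change ((W.quadraticTwist (d : ℚ)).map _).IsElliptic; infer_instance
  have htwK : W'p = Wp.quadraticTwist (d : ℚ_[p]) := by
    rw [hW'p, hWp, baseChange, baseChange, map_quadraticTwist, map_intCast]
  -- the minimal model `X` of `E_p`, its integral model `I`, and the twist `Y = X^{(d)}` over `ℚ_p`
  set X := Wp.minimal ℤ_[p] with hX
  haveI : X.IsElliptic := by rw [hX]; unfold minimal; infer_instance
  obtain ⟨C, hC⟩ : ∃ C : VariableChange ℚ_[p], X = C • Wp := ⟨_, rfl⟩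
  set I := X.integralModel ℤ_[p] with hI
  have hIΔ : I.Δ ≠ 0 := fun h0 ↦ X.isUnit_Δ.ne_zero (by rw [← integralModel_Δ_eq ℤ_[p] X, ← hI, h0, map_zero])
  -- `c₄(I) = p² A`, `c₆(I) = p³ B`
  obtain ⟨A, hA⟩ := exists_eq_pow_mul_of_le_addVal hc₄
  obtain ⟨B, hB⟩ := exists_eq_pow_mul_of_le_addVal hc₆
  set Y := X.quadraticTwist (d : ℚ_[p]) with hY
  haveI : Y.IsElliptic := X.isElliptic_quadraticTwist hdK0
  have hYc₄ : Y.c₄ = (d : ℚ_[p]) ^ 2 * ((p : ℚ_[p]) ^ 2 * (A : ℚ_[p])) := by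
    rw [hY, quadraticTwist_c₄, ← integralModel_c₄_eq ℤ_[p] X, ← hI, hA]; simp
  have hYc₆ : Y.c₆ = (d : ℚ_[p]) ^ 3 * ((p : ℚ_[p]) ^ 3 * (B : ℚ_[p])) := by
    rw [hY, quadraticTwist_c₆, ← integralModel_c₆_eq ℤ_[p] X, ← hI, hB]; simp
  -- the rescaled short model `Z`
  letI : Invertible (2 : ℚ_[p]) := invertibleOfNonzero two_ne_zero
  letI : Invertible (3 : ℚ_[p]) := invertibleOfNonzero three_ne_zero
  set π : ℚ_[p]ˣ := Units.mk0 (p : ℚ_[p]) hp0 with hπ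
  set E : VariableChange ℚ_[p] := ⟨π, 0, 0, 0⟩ * Y.toShortNF with hE
  have hTu : Y.toShortNF.u = 1 := by
    rw [WeierstrassCurve.toShortNF, VariableChange.mul_def]
    simp [WeierstrassCurve.toCharNeTwoNF]
  have hEu : (E.u : ℚ_[p]) = p := by rw [hE, VariableChange.mul_def]; simp [hπ, hTu]
  set Z := E • Y with hZ
  have hs2 : ((d : ℚ_[p])) ^ 2 = (p : ℚ_[p]) ^ 2 := by
    rw [hd]; push_cast
    rw [mul_pow, ← pow_mul, Even.neg_one_pow ⟨p / 2, by ring⟩, one_mul]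
  have hZeq : Z = ({ a₁ := 0, a₂ := 0, a₃ := 0, a₄ := -(A : ℚ_[p]) / 48,
                     a₆ := -((-1 : ℚ_[p]) ^ (p / 2) * (B : ℚ_[p])) / 864 } : WeierstrassCurve ℚ_[p]) := by
    rw [hZ, hE, mul_smul, Y.toShortNF_smul_eq_of_c₄_c₆, scale_smul_short, hYc₄, hYc₆]
    congr 1
    · rw [hπ, Units.val_mk0, hs2]; field_simp
    · rw [hπ, Units.val_mk0, show ((d : ℚ_[p])) ^ 3 = (d : ℚ_[p]) ^ 2 * d by ring, hs2, hd]
      push_cast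
      field_simp
  have hcop : ∀ m n : ℕ, p.Coprime (2 ^ m * 3 ^ n) := by
    intro m n
    rw [Nat.Prime.coprime_iff_not_dvd hp]
    intro h
    rcases (Nat.Prime.dvd_mul hp).mp h with h2 | h3
    · have := Nat.le_of_dvd (by norm_num) (hp.dvd_of_dvd_pow h2); omega
    · have := Nat.le_of_dvd (by norm_num) (hp.dvd_of_dvd_pow h3); omega
  have h48 : ‖(48 : ℚ_[p])‖ = 1 := by
    rw [show (48 : ℚ_[p]) = ((2 ^ 4 * 3 ^ 1 : ℕ) : ℚ_[p]) by norm_num, Padic.norm_natCast_eq_one_iff]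
    exact hcop 4 1
  have h864 : ‖(864 : ℚ_[p])‖ = 1 := by
    rw [show (864 : ℚ_[p]) = ((2 ^ 5 * 3 ^ 3 : ℕ) : ℚ_[p]) by norm_num, Padic.norm_natCast_eq_one_iff]
    exact hcop 5 3
  have n₄ : ‖-(A : ℚ_[p]) / 48‖ ≤ 1 := by
    rw [norm_div, norm_neg, h48, div_one]; exact A.2
  have n₆ : ‖-((-1 : ℚ_[p]) ^ (p / 2) * (B : ℚ_[p])) / 864‖ ≤ 1 := by
    rw [norm_div, norm_neg, h864, div_one, norm_mul, norm_pow, norm_neg, norm_one, one_pow, one_mul]; exact B.2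
  haveI hZint : Z.IsIntegral ℤ_[p] := by
    rw [hZeq]
    exact isIntegral_of_exists_lift _ ⟨0, by simp⟩ ⟨0, by simp⟩ ⟨0, by simp⟩
      (exists_padicInt_algebraMap_eq n₄) (exists_padicInt_algebraMap_eq n₆)
  -- valuations of `Δ(Z)` and `c₄(Z)`
  have hVX : V X.Δ = WithZero.exp (-(a : ℤ)) := by
    rw [← integralModel_Δ_eq ℤ_[p] X]
    exact valuation_algebraMap_eq_exp_neg_of_addVal_eq hΔ
  have hvalp : addVal ℤ_[p] (p : ℤ_[p]) = (1 : ℕ) := by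
    rw [Nat.cast_one]; exact addVal_uniformizer PadicInt.irreducible_p
  have hVp : V (p : ℚ_[p]) = WithZero.exp (-1 : ℤ) := by
    have := valuation_algebraMap_eq_exp_neg_of_addVal_eq (K := ℚ_[p]) hvalp
    simpa using this
  have hVd' : V (algebraMap ℤ_[p] ℚ_[p] (d : ℤ_[p])) = WithZero.exp (-1 : ℤ) := by rw [← hdK]; exact hVd
  have hEuinv : ((E.u⁻¹ : ℚ_[p]ˣ) : ℚ_[p]) = (p : ℚ_[p])⁻¹ := by rw [Units.val_inv_eq_inv_val, hEu]
  -- `Z` is minimal: `ord Δ(Z) = a − 6 < 12`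
  have hVZ : V Z.Δ = WithZero.exp (-((a - 6 : ℕ) : ℤ)) := by
    rw [hZ, variableChange_Δ, hEuinv, hY, quadraticTwist_Δ, Valuation.map_mul, Valuation.map_mul, Valuation.map_pow,
      Valuation.map_pow, map_inv₀, hVp, hVd, hVX, ← WithZero.exp_neg, ← WithZero.exp_nsmul, ← WithZero.exp_nsmul,
      ← WithZero.exp_add, ← WithZero.exp_add, Nat.cast_sub (by omega : 6 ≤ a)]
    congr 1
    simp only [nsmul_eq_mul, neg_neg]
    push_cast
    ring
  haveI hZmin : Z.IsMinimal ℤ_[p] := by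
    refine isMinimal_of_exp_lt_valuation_Δ Z ?_
    change WithZero.exp (-12 : ℤ) < V Z.Δ
    rw [hVZ]
    exact WithZero.exp_lt_exp.mpr (by omega)
  -- the chosen minimal model of `E'_p` is `K`-isomorphic to `Z`
  obtain ⟨C', hC'⟩ : ∃ C' : VariableChange ℚ_[p], W'p.minimal ℤ_[p] = C' • W'p := ⟨_, rfl⟩
  have hYW : Y = ((⟨C.u, (d : ℚ_[p]) * C.r, 0, 0⟩ : VariableChange ℚ_[p])) • W'p := by
    rw [htwK, hY, hC, quadraticTwist_smul]
  have hrel : W'p.minimal ℤ_[p] =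
      (C' * (E * ((⟨C.u, (d : ℚ_[p]) * C.r, 0, 0⟩ : VariableChange ℚ_[p])))⁻¹) • Z := by
    rw [mul_smul, hZ, hYW, ← mul_smul E, inv_smul_smul, ← hC']
  have hZΔ0 : Z.Δ ≠ 0 := by
    intro h0
    have := hVZ
    rw [h0, Valuation.map_zero] at this
    exact WithZero.zero_ne_coe this
  refine ⟨?_, ?_⟩
  · -- `ord Δ`
    rw [addVal_Δ_integralModel_eq_of_isMinimal_of_eq_smul ℤ_[p] hrel]
    have href : addVal ℤ_[p] ((d : ℤ_[p]) ^ (a - 6)) = ((a - 6 : ℕ) : ℕ∞) := by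
      rw [IsDiscreteValuationRing.addVal_pow, hvald, nsmul_one]
    rw [← href]
    apply addVal_eq_addVal_of_valuation_algebraMap_eq ℤ_[p] (L := ℚ_[p])
    rw [integralModel_Δ_eq, map_pow, Valuation.map_pow, hVd', ← WithZero.exp_nsmul]
    change V Z.Δ = _
    rw [hVZ]
    congr 1
    simp
  · -- `ord c₄`
    rw [addVal_c₄_integralModel_eq_of_isMinimal_of_eq_smul ℤ_[p] hrel hZΔ0]
    have hZc₄ : (Z.integralModel ℤ_[p]).c₄ = A := by
      apply IsFractionRing.injective ℤ_[p] ℚ_[p]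
      rw [integralModel_c₄_eq, hZ, variableChange_c₄, hEuinv, hYc₄, hs2,
        show (algebraMap ℤ_[p] ℚ_[p]) A = (A : ℚ_[p]) from rfl]
      field_simp
    rw [hZc₄, hA, IsDiscreteValuationRing.addVal_mul, IsDiscreteValuationRing.addVal_pow, hvalp, add_comm]
    norm_num


/-- **The two local root numbers at `p`, high branch (types IV*, III*, II*).** Let `X` be the chosen `ℤ_p`-minimal model of `E/ℚ_p`,
`p ≥ 5`, ADDITIVE POTENTIALLY GOOD with `ord_p Δ(X) = a ∈ {8, 9, 10}` (`e = 12/gcd(12,a) = 3, 4, 6`), `ord_p c₄(X) > 0`,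
`3·ord_p c₄(X) ≥ ord_p Δ(X)`. Then (`ord_p c₄ ≥ 3`, and `ord_p c₆ ≥ 4` by `c₄³ − c₆² = 1728Δ`) the minimal model of `E' = E^{(p*)}` at `p`
has `ord_p Δ = a − 6 ∈ {2, 3, 4}` (`e' = 6, 4, 3`), both are additive potentially good, and Rohrlich's case list gives
`W_p(E)·W_p(E') = (−3/p)·(−1/p)` for `a ∈ {8, 10}` and `(−2/p)² = 1` for `a = 9` — the same table as for types IV, III, II.
[cite: Rohrlich1993Compositio, Prop. 2(iv)] [cite: SilvermanAEC2009, VII.1 Remark 1.1] -/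
theorem localRootNumber_mul_pStarTwist_padic_of_ge (W : WeierstrassCurve ℚ) [W.IsElliptic] (hp5 : 5 ≤ p) {a : ℕ}
    (hΔ : addVal ℤ_[p] (((W.baseChange ℚ_[p]).minimal ℤ_[p]).integralModel ℤ_[p]).Δ = a)
    (ha : a = 8 ∨ a = 9 ∨ a = 10)
    (hc₄ : addVal ℤ_[p] (((W.baseChange ℚ_[p]).minimal ℤ_[p]).integralModel ℤ_[p]).c₄ ≠ 0)
    (hj : ¬ 3 * addVal ℤ_[p] (((W.baseChange ℚ_[p]).minimal ℤ_[p]).integralModel ℤ_[p]).c₄ <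
      addVal ℤ_[p] (((W.baseChange ℚ_[p]).minimal ℤ_[p]).integralModel ℤ_[p]).Δ) :
    ((W.baseChange ℚ_[p]).minimal ℤ_[p]).HasAdditiveReduction ℤ_[p] ∧
      (((W.quadraticTwist (((-1 : ℤ) ^ (p / 2) * p : ℤ) : ℚ)).baseChange ℚ_[p]).minimal ℤ_[p]).HasAdditiveReduction
        ℤ_[p] ∧
      (W.baseChange ℚ_[p]).localRootNumber ℤ_[p] *
          ((W.quadraticTwist (((-1 : ℤ) ^ (p / 2) * p : ℤ) : ℚ)).baseChange ℚ_[p]).localRootNumber ℤ_[p] =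
        if a = 9 then 1 else ZMod.χ₄ p * (if p % 3 = 1 then 1 else -1) := by
  have hp2 : p ≠ 2 := by omega
  have hpodd : p % 2 = 1 := (Nat.Prime.eq_two_or_odd (Fact.out : p.Prime)).resolve_left hp2
  set I := ((W.baseChange ℚ_[p]).minimal ℤ_[p]).integralModel ℤ_[p] with hI
  set I' := (((W.quadraticTwist (((-1 : ℤ) ^ (p / 2) * p : ℤ) : ℚ)).baseChange ℚ_[p]).minimal
    ℤ_[p]).integralModel ℤ_[p] with hI'
  -- `ord c₄ ≥ 3` from `3 ord c₄ ≥ a ≥ 8`; write `ord c₄ = c`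
  have hc3 : (3 : ℕ∞) ≤ addVal ℤ_[p] I.c₄ := by
    by_cases htop : addVal ℤ_[p] I.c₄ = ⊤
    · rw [htop]; exact le_top
    · obtain ⟨c, hc⟩ := ENat.ne_top_iff_exists.mp htop
      rw [← hc] at hj ⊢
      rw [hΔ] at hj
      have h1 : ¬ ((3 * c : ℕ) : ℕ∞) < (a : ℕ∞) := by push_cast; exact hj
      have h2 : ¬ 3 * c < a := fun h ↦ h1 (by exact_mod_cast h)
      exact_mod_cast (show 3 ≤ c by omega)
  -- `ord c₆ ≥ 4` from `c₆² = c₄³ − 1728 Δ`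
  have hc₆ : (3 : ℕ∞) ≤ addVal ℤ_[p] I.c₆ := by
    have hrel : I.c₆ ^ 2 = I.c₄ ^ 3 - 1728 * I.Δ := by linear_combination I.c_relation
    have h1 : min (addVal ℤ_[p] (I.c₄ ^ 3)) (addVal ℤ_[p] (1728 * I.Δ)) ≤ addVal ℤ_[p] (I.c₆ ^ 2) := by
      rw [hrel]; exact AddValuation.map_sub _ _ _
    rw [IsDiscreteValuationRing.addVal_pow, IsDiscreteValuationRing.addVal_pow, IsDiscreteValuationRing.addVal_mul, hΔ] at h1
    have h8 : (8 : ℕ∞) ≤ min (3 • addVal ℤ_[p] I.c₄) (addVal ℤ_[p] (1728 : ℤ_[p]) + (a : ℕ∞)) := by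
      refine le_min ?_ ?_
      · calc (8 : ℕ∞) ≤ 3 • (3 : ℕ∞) := by norm_num
          _ ≤ 3 • addVal ℤ_[p] I.c₄ := nsmul_le_nsmul_right hc3 3
      · calc (8 : ℕ∞) ≤ (a : ℕ∞) := by exact_mod_cast (show 8 ≤ a by omega)
          _ ≤ _ := le_add_self
    have h2 : (8 : ℕ∞) ≤ 2 • addVal ℤ_[p] I.c₆ := h8.trans h1
    by_cases htop : addVal ℤ_[p] I.c₆ = ⊤
    · rw [htop]; exact le_top
    · obtain ⟨s, hs⟩ := ENat.ne_top_iff_exists.mp htop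
      rw [← hs] at h2 ⊢
      have h3 : ((8 : ℕ) : ℕ∞) ≤ ((2 * s : ℕ) : ℕ∞) := by
        rw [Nat.cast_mul]; simpa [nsmul_eq_mul] using h2
      have h4 : 8 ≤ 2 * s := by exact_mod_cast h3
      exact_mod_cast (show 3 ≤ s by omega)
  obtain ⟨hΔ', hc₄'⟩ := addVal_minimal_pStarTwist_padic_of_ge W hp5 hΔ (by omega) (by omega)
    (le_trans (by norm_num) hc3) hc₆
  rw [← hI'] at hΔ' hc₄'
  have ha0 : addVal ℤ_[p] I.Δ ≠ 0 := by rw [hΔ]; exact_mod_cast (show a ≠ 0 by omega)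
  have ha0' : addVal ℤ_[p] I'.Δ ≠ 0 := by rw [hΔ']; exact_mod_cast (show a - 6 ≠ 0 by omega)
  have hc0' : addVal ℤ_[p] I'.c₄ ≠ 0 := by
    intro h
    rw [h, zero_add] at hc₄'
    rw [← hc₄'] at hc3
    exact absurd hc3 (by norm_num)
  have hadd := hasAdditiveReduction_minimal_padic_of_addVal (W.baseChange ℚ_[p]) ha0 hc₄
  have hadd' := hasAdditiveReduction_minimal_padic_of_addVal
    ((W.quadraticTwist (((-1 : ℤ) ^ (p / 2) * p : ℤ) : ℚ)).baseChange ℚ_[p]) ha0' hc0'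
  refine ⟨hadd, hadd', ?_⟩
  -- potentially good for the twist: `3 (c − 2) ≥ a − 6`
  have hj' : ¬ 3 * addVal ℤ_[p] I'.c₄ < addVal ℤ_[p] I'.Δ := by
    rw [hΔ']
    intro hlt
    apply hj
    rw [hΔ, ← hc₄']
    by_cases htop : addVal ℤ_[p] I'.c₄ = ⊤
    · simp [htop] at hlt
    · obtain ⟨c, hc⟩ := ENat.ne_top_iff_exists.mp htop
      rw [← hc] at hlt ⊢
      have h1 : ((3 * c : ℕ) : ℕ∞) < ((a - 6 : ℕ) : ℕ∞) := by push_cast at hlt ⊢; exact hlt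
      have h2 : 3 * c < a - 6 := by exact_mod_cast h1
      have h3 : ((3 * (c + 2) : ℕ) : ℕ∞) < (a : ℕ∞) := by exact_mod_cast (show 3 * (c + 2) < a by omega)
      push_cast at h3 ⊢
      exact h3
  rw [localRootNumber_padic_of_hasAdditiveReduction p _ hp5 hadd,
    localRootNumber_padic_of_hasAdditiveReduction p _ hp5 hadd', if_neg hj, if_neg hj']
  rw [← hI, ← hI', hΔ, hΔ']
  simp only [ENat.toNat_coe]
  rcases ha with rfl | rfl | rfl
  · -- `a = 8`: `e = 3`, `e' = 6`
    have e1 : 12 / Nat.gcd 8 12 = 3 := by decide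
    have e2 : 12 / Nat.gcd (8 - 6) 12 = 6 := by decide
    simp only [e1, e2]
    norm_num
  · -- `a = 9`: `e = e' = 4`
    have e1 : 12 / Nat.gcd 9 12 = 4 := by decide
    have e2 : 12 / Nat.gcd (9 - 6) 12 = 4 := by decide
    simp only [e1, e2]
    norm_num
    exact χ₈'_mul_self_of_odd hpodd
  · -- `a = 10`: `e = 6`, `e' = 3`
    have e1 : 12 / Nat.gcd 10 12 = 6 := by decide
    have e2 : 12 / Nat.gcd (10 - 6) 12 = 3 := by decide
    simp only [e1, e2]
    norm_num

end PadicStarred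

end Summit.BirchSwinnertonDyer.BirchSwinnertonDyer.Theorems.AdditiveKoly.RamifiedHabitat

end
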